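import Summits.Parity.GeneralizedHardyLittlewood.Theorems.PrimeLevelFamEdgeMomentsBeyondDiagonalDictionaryAtOne
import Literature.NumberTheory.LFunctions.KMVMomentsToHalfEdge
import Literature.NumberTheory.LFunctions.KMVCutoffW
import Literature.NumberTheory.LFunctions.KowalskiMichelPeterssonBoundWeilFree
import Literature.NumberTheory.LFunctions.Bettin2017DualTail
import Literature.NumberTheory.Sieve.DivisorBound
import Mathlib.Analysis.Complex.Exponential
import HarnessLib

/-!
# Route `PrimeLevelFamEdge`, crux K_A `MomentsBeyondDiagonal` (stmt-Parity-20007), line «petersson_layers» v4: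
# ELEMENTARY BOUNDS for the truncation of the `Q = 1` dictionary (lead prover, 2026-08-28; helper)

Bookkeeping lemmas, all unconditional, used to pass from the EXACT de-automorphised series of
`…DictionaryAtOne` (`QhPQ_one_eq_tsum_delta_sub_petJ`) to the FINITE explicit pieces `diagPart` / `layer r` of deck 21a
(box `nᵢ ≤ q²`, layers `r ≤ q⁸`):
* §1 `spectralSum` is linear in its pair kernel (`spectralSum_kernel_add/sub/finset_sum`) and at `Q = 1` collapses to its
  `i = j = 0` slice (`spectralSum_one`).
* §2 sizes: `|P| ≤ Σ|aᵢ|` on `[0,1]`; `|x_m| ≤ ‖P‖ m^{−1/2}` (tree `KMV2000.abs_mollifierCoeff_le`); KMV's cut-off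
  `W(y) ≤ 2·k!·y^{−k/2}` (from the tree's `W(y) ≤ 2e^{−√y}` and `e^{−x} ≤ k!/x^k`); the harmonic pair average
  `|Σʰ λ_f(a)λ_f(b)| ≤ (1 + K) a b` (Petersson + the tree's all-range bound on `J(a,b)`); one Kloosterman–Bessel layer term
  `|r⁻¹S(a,b;qr)J₁| ≤ 4πC √(a,b) √(ab) q^{−1/2} r^{−3/2+ε}` (Weil's bound, a tree theorem, with `τ(r) ≤ C r^ε`) and the tail
  `Σ_{r>R} r^{−3/2+ε} ≤ ζ(1+δ)(R+1)^{−(1/2−ε−δ)}`.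
Nothing here is a moment asymptotic or a statement about K_A; no exceptional-zero claim (no GRH, no Landau–Siegel).
-/

noncomputable section

open scoped MatrixGroups Real Nat
open CongruenceSubgroup Complex Finset Polynomial MeasureTheory
open Literature.NumberTheory.EllipticCurves.ModularForms
open Literature.NumberTheory.LFunctions

namespace Summit.Parity.GeneralizedHardyLittlewood.Theorems.PrimeLevelFamEdgeIdeaDeltas.PeterssonLayers

/-! ## §1. `spectralSum`: linearity in the pair kernel, and the `Q = 1` slice -/

section Kernel

variable (q : ℕ) (P Q : ℝ[X]) (Δ' : ℝ)

/-- `spectralSum` is additive in the pair kernel `κ`. -/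
theorem spectralSum_kernel_add (κ₁ κ₂ : ℕ → ℕ → ℂ) :
    spectralSum q P Q Δ' (fun a b ↦ κ₁ a b + κ₂ a b) = spectralSum q P Q Δ' κ₁ + spectralSum q P Q Δ' κ₂ := by
  simp only [spectralSum, Finset.sum_add_distrib, mul_add]

/-- `spectralSum` respects differences of pair kernels. -/
theorem spectralSum_kernel_sub (κ₁ κ₂ : ℕ → ℕ → ℂ) :
    spectralSum q P Q Δ' (fun a b ↦ κ₁ a b - κ₂ a b) = spectralSum q P Q Δ' κ₁ - spectralSum q P Q Δ' κ₂ := by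
  simp only [spectralSum, Finset.sum_sub_distrib, mul_sub]

/-- `spectralSum` of a finite sum of kernels is the sum of the `spectralSum`s (so `Σ_{r∈s} layer r` is ONE spectral sum). -/
theorem spectralSum_kernel_finset_sum {ι : Type*} (s : Finset ι) (κ : ι → ℕ → ℕ → ℂ) :
    spectralSum q P Q Δ' (fun a b ↦ ∑ i ∈ s, κ i a b) = ∑ i ∈ s, spectralSum q P Q Δ' (κ i) := by
  classical
  induction s using Finset.induction_on with
  | empty => simp [spectralSum]
  | insert i s hi ih =>
      simp only [Finset.sum_insert hi]
      rw [← ih, ← spectralSum_kernel_add]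

/-- **At `Q = 1` the spectral sum is its `i = j = 0` slice**:
`spectralSum q P 1 Δ' κ = 2q̂ Σ_{n₁,n₂ ≤ q²} (n₁n₂)^{−1/2} W₀₀(q̂;n₁,n₂) Σ_{m₁,m₂ ≤ M} x_{m₁}x_{m₂} Σ_{d₁,d₂} κ(a,b)`. -/
theorem spectralSum_one (κ : ℕ → ℕ → ℂ) :
    spectralSum q P 1 Δ' κ = 2 * (KMV2000.qhat q : ℂ) *
      ∑ n₁ ∈ afeBox q, ∑ n₂ ∈ afeBox q,
        ((((n₁ : ℝ) * n₂) ^ (-(1 / 2 : ℝ)) : ℝ) : ℂ) * afeW (KMV2000.qhat q) 0 0 n₁ n₂ *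
        ∑ m₁ ∈ Icc 1 ⌊KMV2000.qhat q ^ Δ'⌋₊, ∑ m₂ ∈ Icc 1 ⌊KMV2000.qhat q ^ Δ'⌋₊,
          (KMV2000.mollifierCoeff P (KMV2000.qhat q ^ Δ') m₁ : ℂ) *
            (KMV2000.mollifierCoeff P (KMV2000.qhat q ^ Δ') m₂ : ℂ) *
          ∑ d₁ ∈ (Nat.gcd m₁ n₁).divisors, ∑ d₂ ∈ (Nat.gcd m₂ n₂).divisors,
            κ (m₁ * n₁ / d₁ ^ 2) (m₂ * n₂ / d₂ ^ 2) := by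
  unfold spectralSum
  rw [Polynomial.natDegree_one]
  simp only [zero_add, Finset.sum_range_one, Polynomial.coeff_one_zero, Complex.ofReal_one, one_mul, pow_zero,
    add_zero]
  norm_num

end Kernel

/-! ## §2. Sizes -/

/-- A real polynomial is bounded on `[0,1]` by the sum of the moduli of its coefficients. -/
theorem abs_eval_le_sum_abs_coeff (P : ℝ[X]) {t : ℝ} (ht : t ∈ Set.Icc (0 : ℝ) 1) :
    |P.eval t| ≤ ∑ i ∈ range (P.natDegree + 1), |P.coeff i| := by
  rw [Polynomial.eval_eq_sum_range]
  refine (Finset.abs_sum_le_sum_abs _ _).trans (Finset.sum_le_sum fun i _ ↦ ?_)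
  rw [abs_mul]
  have h1 : |t ^ i| ≤ 1 := by
    rw [abs_pow]
    exact pow_le_one₀ (abs_nonneg t) (abs_le.mpr ⟨by linarith [ht.1], ht.2⟩)
  calc |P.coeff i| * |t ^ i| ≤ |P.coeff i| * 1 := by gcongr
    _ = |P.coeff i| := mul_one _

/-- `‖x_m‖ ≤ ‖P‖_{[0,1]} · m^{−1/2}` for `1 ≤ m ≤ M`, `M > 1` (the tree's `KMV2000.abs_mollifierCoeff_le`, complex form). -/
theorem norm_mollifierCoeff_le {P : ℝ[X]} {B : ℝ} (hB : ∀ t ∈ Set.Icc (0 : ℝ) 1, |P.eval t| ≤ B)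
    {M : ℝ} (hM : 1 < M) {m : ℕ} (hm : m ∈ Icc 1 ⌊M⌋₊) :
    ‖(KMV2000.mollifierCoeff P M m : ℂ)‖ ≤ B * (m : ℝ) ^ (-(1 / 2 : ℝ)) := by
  rw [Complex.norm_real, Real.norm_eq_abs, KMV2000.mollifierCoeff]
  exact KMV2000.abs_mollifierCoeff_le hB hM hm

/-- **KMV's cut-off decays like any power**: `W(y) ≤ 2·k!·y^{−k/2}` for `y > 0` (the tree's `W(y) ≤ 2e^{−√y}` with
`e^{−√y} ≤ k!/√y^k`). -/
theorem cutoffW_le_factorial_mul_rpow {y : ℝ} (hy : 0 < y) (k : ℕ) :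
    KMV2000.cutoffW y ≤ 2 * (k ! : ℝ) * y ^ (-((k : ℝ) / 2)) := by
  have h1 := KMV2000.cutoffW_le_two_mul_exp_neg_sqrt hy.le
  have hs : 0 < Real.sqrt y := Real.sqrt_pos.mpr hy
  -- `e^{-x} ≤ k!/x^k` (the tree's `GoldwasserSipser.exp_neg_le_factorial_div_pow`, re-derived inline from
  -- `Real.pow_div_factorial_le_exp` to keep the import list number-theoretic)
  have h2 : Real.exp (-Real.sqrt y) ≤ (k ! : ℝ) / Real.sqrt y ^ k := by
    have h : Real.sqrt y ^ k / (k ! : ℝ) ≤ Real.exp (Real.sqrt y) := Real.pow_div_factorial_le_exp _ hs.le k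
    have hj : (0 : ℝ) < k ! := by exact_mod_cast Nat.factorial_pos k
    rw [Real.exp_neg, inv_le_comm₀ (Real.exp_pos _) (div_pos hj (pow_pos hs k)), inv_div]
    exact h
  have hpow : Real.sqrt y ^ k = y ^ ((k : ℝ) / 2) := by
    rw [Real.sqrt_eq_rpow, ← Real.rpow_natCast, ← Real.rpow_mul hy.le]
    ring_nf
  calc KMV2000.cutoffW y ≤ 2 * Real.exp (-Real.sqrt y) := h1
    _ ≤ 2 * ((k ! : ℝ) / Real.sqrt y ^ k) := by gcongr
    _ = 2 * (k ! : ℝ) * y ^ (-((k : ℝ) / 2)) := by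
        rw [hpow, Real.rpow_neg hy.le, div_eq_mul_inv]
        ring

/-- **The cut-off far out**: for `y ≥ y₀ > 0`, `W(y) ≤ 2·k!·2^k · e^{−√y₀/2} · y^{−k/2}` (split `e^{−√y} = e^{−√y/2}e^{−√y/2}`,
bound one factor at `y₀` and the other by `k!/(√y/2)^k`). -/
theorem cutoffW_le_exp_mul_rpow {y y₀ : ℝ} (hy₀ : 0 < y₀) (hy : y₀ ≤ y) (k : ℕ) :
    KMV2000.cutoffW y ≤ 2 * (k ! : ℝ) * 2 ^ k * Real.exp (-(Real.sqrt y₀ / 2)) * y ^ (-((k : ℝ) / 2)) := by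
  have hy' : 0 < y := lt_of_lt_of_le hy₀ hy
  have h1 := KMV2000.cutoffW_le_two_mul_exp_neg_sqrt hy'.le
  have hs : 0 < Real.sqrt y := Real.sqrt_pos.mpr hy'
  have hsplit : Real.exp (-Real.sqrt y) = Real.exp (-(Real.sqrt y / 2)) * Real.exp (-(Real.sqrt y / 2)) := by
    rw [← Real.exp_add]; ring_nf
  have hA : Real.exp (-(Real.sqrt y / 2)) ≤ Real.exp (-(Real.sqrt y₀ / 2)) := by
    apply Real.exp_le_exp.mpr
    have := Real.sqrt_le_sqrt hy
    linarith
  have hB : Real.exp (-(Real.sqrt y / 2)) ≤ (k ! : ℝ) / (Real.sqrt y / 2) ^ k := by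
    have hs2 : 0 < Real.sqrt y / 2 := by positivity
    have h : (Real.sqrt y / 2) ^ k / (k ! : ℝ) ≤ Real.exp (Real.sqrt y / 2) :=
      Real.pow_div_factorial_le_exp _ hs2.le k
    have hj : (0 : ℝ) < k ! := by exact_mod_cast Nat.factorial_pos k
    rw [Real.exp_neg, inv_le_comm₀ (Real.exp_pos _) (div_pos hj (pow_pos hs2 k)), inv_div]
    exact h
  have hpow : (Real.sqrt y / 2) ^ k = y ^ ((k : ℝ) / 2) / 2 ^ k := by
    rw [div_pow, Real.sqrt_eq_rpow, ← Real.rpow_natCast (y ^ (1 / 2 : ℝ)), ← Real.rpow_mul hy'.le]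
    ring_nf
  have hykpos : 0 < y ^ ((k : ℝ) / 2) := Real.rpow_pos_of_pos hy' _
  calc KMV2000.cutoffW y ≤ 2 * Real.exp (-Real.sqrt y) := h1
    _ = 2 * (Real.exp (-(Real.sqrt y / 2)) * Real.exp (-(Real.sqrt y / 2))) := by rw [hsplit]
    _ ≤ 2 * (Real.exp (-(Real.sqrt y₀ / 2)) * ((k ! : ℝ) / (Real.sqrt y / 2) ^ k)) := by
        gcongr
    _ = 2 * (k ! : ℝ) * 2 ^ k * Real.exp (-(Real.sqrt y₀ / 2)) * y ^ (-((k : ℝ) / 2)) := by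
        rw [hpow, Real.rpow_neg hy'.le]
        field_simp

/-- **The harmonic pair average is at most polynomial**: for `q` prime and `a, b ≥ 1`,
`‖Σʰ_f λ_f(a)λ_f(b)‖ ≤ (1 + K)·a·b` with the constant `K` of the tree's all-range bound
`‖J(a,b)‖ ≤ K√(a,b)√(ab)q^{−3/2}` (`Bettin2017.norm_petJ_le_all`) and Petersson's formula `Σʰλλ = δ − J`. -/
theorem exists_norm_pet_le :
    ∃ K : ℝ, 0 ≤ K ∧ ∀ (q : ℕ) [NeZero q], q.Prime → ∀ a b : ℕ, 1 ≤ a → 1 ≤ b →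
      ‖KowalskiMichel2000.pet q a b‖ ≤ (1 + K) * a * b := by
  obtain ⟨K, hK0, hK⟩ := KowalskiMichel2000.norm_petJ_le_all
  refine ⟨K, hK0, fun q _ hq a b ha hb ↦ ?_⟩
  have hP := (KowalskiMichel2000.kowalskiMichel2000_peterssonFormula_holds q hq a b ha hb).2
  rw [hP]
  have ha0 : (1 : ℝ) ≤ a := by exact_mod_cast ha
  have hb0 : (1 : ℝ) ≤ b := by exact_mod_cast hb
  have hq1 : (1 : ℝ) ≤ q := by exact_mod_cast hq.one_lt.le
  have hJ := hK q hq a b ha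
  -- `√(a,b) √(ab) q^{-3/2} ≤ a b`
  have hg : Real.sqrt ((a.gcd b : ℕ) : ℝ) ≤ Real.sqrt a :=
    Real.sqrt_le_sqrt (by exact_mod_cast Nat.gcd_le_left b ha)
  have h1 : Real.sqrt ((a.gcd b : ℕ) : ℝ) * Real.sqrt ((a : ℝ) * b) * (q : ℝ) ^ (-(3 / 2 : ℝ)) ≤ (a : ℝ) * b := by
    have hq' : (q : ℝ) ^ (-(3 / 2 : ℝ)) ≤ 1 := Real.rpow_le_one_of_one_le_of_nonpos hq1 (by norm_num)
    have hab : Real.sqrt a * Real.sqrt ((a : ℝ) * b) ≤ (a : ℝ) * b := by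
      rw [← Real.sqrt_mul (by positivity)]
      calc Real.sqrt ((a : ℝ) * ((a : ℝ) * b)) ≤ Real.sqrt (((a : ℝ) * b) ^ 2) :=
            Real.sqrt_le_sqrt (by nlinarith)
        _ = (a : ℝ) * b := Real.sqrt_sq (by positivity)
    calc Real.sqrt ((a.gcd b : ℕ) : ℝ) * Real.sqrt ((a : ℝ) * b) * (q : ℝ) ^ (-(3 / 2 : ℝ))
        ≤ Real.sqrt a * Real.sqrt ((a : ℝ) * b) * 1 := by gcongr
      _ ≤ (a : ℝ) * b := by rw [mul_one]; exact hab
  have hδ : ‖(if a = b then (1 : ℂ) else 0)‖ ≤ 1 := by split_ifs <;> simp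
  calc ‖(if a = b then (1 : ℂ) else 0) - KowalskiMichel2000.petJ q a b‖
      ≤ ‖(if a = b then (1 : ℂ) else 0)‖ + ‖KowalskiMichel2000.petJ q a b‖ := norm_sub_le _ _
    _ ≤ 1 + K * Real.sqrt ((a.gcd b : ℕ) : ℝ) * Real.sqrt ((a : ℝ) * b) * (q : ℝ) ^ (-(3 / 2 : ℝ)) :=
        add_le_add hδ hJ
    _ ≤ 1 + K * ((a : ℝ) * b) := by
        have := mul_le_mul_of_nonneg_left h1 hK0
        linarith [this]
    _ ≤ (1 + K) * a * b := by nlinarith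

/-- **One Kloosterman–Bessel layer term, with the full Weil decay in `r`**: for `q` prime, `a ≥ 1`, any `b`, and a divisor
bound `τ(r) ≤ C r^ε`: `‖r⁻¹ S(a,b;qr) J₁(4π√(ab)/(qr))‖ ≤ 4πC √(a,b) √(ab) q^{−1/2} r^{−(3/2−ε)}` (Weil's bound — the tree's
theorem `weil_kloosterman_bound_holds` — with `((a,b),qr) ≤ (a,b)`, `τ(qr) ≤ 2τ(r)`, `|J₁(x)| ≤ x/2`). -/
theorem norm_petKloostermanTerm_le_rpow {q : ℕ} [NeZero q] (hq : q.Prime) {a b : ℕ} (ha : 1 ≤ a)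
    {ε C : ℝ} (hC : ∀ r : ℕ, ((r.divisors.card : ℕ) : ℝ) ≤ C * (r : ℝ) ^ ε) (r : ℕ) (hr : r ≠ 0) :
    ‖KowalskiMichel2000.petKloostermanTerm q a b r‖ ≤
      4 * π * C * Real.sqrt ((a.gcd b : ℕ) : ℝ) * Real.sqrt ((a : ℝ) * b) *
        (q : ℝ) ^ (-(1 / 2 : ℝ)) * (r : ℝ) ^ (-(3 / 2 - ε)) := by
  haveI : NeZero (q * r) := ⟨mul_ne_zero hq.ne_zero hr⟩
  have hq0 : (0 : ℝ) < q := by exact_mod_cast hq.pos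
  have hr0 : (0 : ℝ) < r := by exact_mod_cast Nat.pos_of_ne_zero hr
  have hC0 : 0 ≤ C := by
    have h := hC 1
    simp at h
    linarith
  set g : ℕ := a.gcd b with hgdef
  have hgpos : 0 < g := Nat.gcd_pos_of_pos_left b (by omega)
  have hWeil : ‖kloostermanSum (q * r) (a : ZMod (q * r)) (b : ZMod (q * r))‖ ≤
      Real.sqrt (Nat.gcd g (q * r) : ℕ) * Real.sqrt ((q : ℝ) * r) *
        (((q * r).divisors.card : ℕ) : ℝ) := by
    have h := weil_kloosterman_bound_holds (q * r) (a : ℤ) (b : ℤ)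
    simp only [Int.cast_natCast, Int.natAbs_natCast, Nat.cast_mul] at h
    exact h
  have hgcd : Real.sqrt (Nat.gcd g (q * r) : ℕ) ≤ Real.sqrt (g : ℝ) :=
    Real.sqrt_le_sqrt (by exact_mod_cast Nat.gcd_le_left (q * r) hgpos)
  have hτ : (((q * r).divisors.card : ℕ) : ℝ) ≤ 2 * C * (r : ℝ) ^ ε := by
    calc (((q * r).divisors.card : ℕ) : ℝ) ≤ ((2 * r.divisors.card : ℕ) : ℝ) := by
          exact_mod_cast KowalskiMichel2000.card_divisors_prime_mul_le hq hr
      _ = 2 * ((r.divisors.card : ℕ) : ℝ) := by push_cast; ring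
      _ ≤ 2 * (C * (r : ℝ) ^ ε) := by
          gcongr
          exact hC r
      _ = 2 * C * (r : ℝ) ^ ε := by ring
  have hx0 : 0 ≤ 4 * π * Real.sqrt ((a : ℝ) * b) / ((q : ℝ) * r) := by positivity
  have hJ : |Literature.Analysis.FunctionSpaces.besselJ 1 (4 * π * Real.sqrt ((a : ℝ) * b) / ((q : ℝ) * r))| ≤
      (4 * π * Real.sqrt ((a : ℝ) * b) / ((q : ℝ) * r)) / 2 :=
    Literature.Analysis.FunctionSpaces.abs_besselJ_one_le_half_mul hx0
  rw [KowalskiMichel2000.petKloostermanTerm_of_ne_zero q a b hr]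
  rw [norm_mul, norm_mul, norm_inv, Complex.norm_natCast, Complex.norm_real, Real.norm_eq_abs]
  calc (r : ℝ)⁻¹ * ‖kloostermanSum (q * r) (a : ZMod (q * r)) (b : ZMod (q * r))‖ *
        |Literature.Analysis.FunctionSpaces.besselJ 1 (4 * π * Real.sqrt ((a : ℝ) * b) / ((q : ℝ) * r))|
      ≤ (r : ℝ)⁻¹ * (Real.sqrt (g : ℝ) * Real.sqrt ((q : ℝ) * r) * (2 * C * (r : ℝ) ^ ε)) *
          ((4 * π * Real.sqrt ((a : ℝ) * b) / ((q : ℝ) * r)) / 2) := by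
        gcongr
        calc ‖kloostermanSum (q * r) (a : ZMod (q * r)) (b : ZMod (q * r))‖
            ≤ Real.sqrt (Nat.gcd g (q * r) : ℕ) * Real.sqrt ((q : ℝ) * r) *
                (((q * r).divisors.card : ℕ) : ℝ) := hWeil
          _ ≤ Real.sqrt (g : ℝ) * Real.sqrt ((q : ℝ) * r) * (2 * C * (r : ℝ) ^ ε) := by gcongr
    _ = 4 * π * C * Real.sqrt (g : ℝ) * Real.sqrt ((a : ℝ) * b) * (q : ℝ) ^ (-(1 / 2 : ℝ)) *
          (r : ℝ) ^ (-(3 / 2 - ε)) := by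
        rw [Real.sqrt_eq_rpow ((q : ℝ) * r), Real.mul_rpow hq0.le hr0.le]
        have er : (r : ℝ)⁻¹ * (r : ℝ) ^ (1 / 2 : ℝ) * (r : ℝ) ^ ε / (r : ℝ) =
            (r : ℝ) ^ (-(3 / 2 - ε)) := by
          rw [← Real.rpow_neg_one, div_eq_mul_inv, ← Real.rpow_neg_one, ← Real.rpow_add hr0,
            ← Real.rpow_add hr0, ← Real.rpow_add hr0]
          congr 1
          ring
        have eq' : (q : ℝ) ^ (1 / 2 : ℝ) / (q : ℝ) = (q : ℝ) ^ (-(1 / 2 : ℝ)) := by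
          rw [div_eq_mul_inv, ← Real.rpow_neg_one, ← Real.rpow_add hq0]
          congr 1
          ring
        calc (r : ℝ)⁻¹ * (Real.sqrt (g : ℝ) * ((q : ℝ) ^ (1 / 2 : ℝ) * (r : ℝ) ^ (1 / 2 : ℝ)) *
              (2 * C * (r : ℝ) ^ ε)) *
              ((4 * π * Real.sqrt ((a : ℝ) * b) / ((q : ℝ) * r)) / 2)
            = 4 * π * C * Real.sqrt (g : ℝ) * Real.sqrt ((a : ℝ) * b) *
                ((q : ℝ) ^ (1 / 2 : ℝ) / (q : ℝ)) *
                ((r : ℝ)⁻¹ * (r : ℝ) ^ (1 / 2 : ℝ) * (r : ℝ) ^ ε / (r : ℝ)) := by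
              field_simp
          _ = _ := by rw [er, eq']

/-! ## §3. Tails of `r`-series and the double zeta constant -/

/-- `Σ_k (k+1)^{−21/20}` converges. -/
theorem summable_succ_rpow : Summable (fun k : ℕ ↦ (((k + 1 : ℕ) : ℝ)) ^ (-(21 / 20 : ℝ))) := by
  have h := (Real.summable_nat_rpow.mpr (by norm_num : (-(21 / 20 : ℝ)) < -1))
  exact (summable_nat_add_iff 1).mpr h

/-- **Tail of the layer series in `r`**: `Σ_{k ≥ 0} (k+R+1)^{−29/20} ≤ ζ_ℕ(21/20) · (R+1)^{−2/5}`
(`(k+R+1)^{−29/20} ≤ (k+1)^{−21/20}(R+1)^{−2/5}`). -/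
theorem tsum_shift_rpow_le (R : ℕ) :
    Summable (fun k : ℕ ↦ (((k + R + 1 : ℕ) : ℝ)) ^ (-(29 / 20 : ℝ))) ∧
      ∑' k : ℕ, (((k + R + 1 : ℕ) : ℝ)) ^ (-(29 / 20 : ℝ)) ≤
        (∑' k : ℕ, (((k + 1 : ℕ) : ℝ)) ^ (-(21 / 20 : ℝ))) * (((R + 1 : ℕ) : ℝ)) ^ (-(2 / 5 : ℝ)) := by
  have hR : (0 : ℝ) < ((R + 1 : ℕ) : ℝ) := by positivity
  have hpt : ∀ k : ℕ, (((k + R + 1 : ℕ) : ℝ)) ^ (-(29 / 20 : ℝ)) ≤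
      (((k + 1 : ℕ) : ℝ)) ^ (-(21 / 20 : ℝ)) * (((R + 1 : ℕ) : ℝ)) ^ (-(2 / 5 : ℝ)) := by
    intro k
    have hk : (0 : ℝ) < ((k + R + 1 : ℕ) : ℝ) := by positivity
    have hk1 : (0 : ℝ) < ((k + 1 : ℕ) : ℝ) := by positivity
    have hsplit : (((k + R + 1 : ℕ) : ℝ)) ^ (-(29 / 20 : ℝ)) =
        (((k + R + 1 : ℕ) : ℝ)) ^ (-(21 / 20 : ℝ)) * (((k + R + 1 : ℕ) : ℝ)) ^ (-(2 / 5 : ℝ)) := by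
      rw [← Real.rpow_add hk]; norm_num
    rw [hsplit]
    have hle1 : (((k + 1 : ℕ) : ℝ)) ≤ ((k + R + 1 : ℕ) : ℝ) := by push_cast; linarith [(Nat.cast_nonneg R : (0:ℝ) ≤ R)]
    have hle2 : (((R + 1 : ℕ) : ℝ)) ≤ ((k + R + 1 : ℕ) : ℝ) := by push_cast; linarith [(Nat.cast_nonneg k : (0:ℝ) ≤ k)]
    have h1 : (((k + R + 1 : ℕ) : ℝ)) ^ (-(21 / 20 : ℝ)) ≤ (((k + 1 : ℕ) : ℝ)) ^ (-(21 / 20 : ℝ)) :=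
      Real.rpow_le_rpow_of_nonpos hk1 hle1 (by norm_num)
    have h2 : (((k + R + 1 : ℕ) : ℝ)) ^ (-(2 / 5 : ℝ)) ≤ (((R + 1 : ℕ) : ℝ)) ^ (-(2 / 5 : ℝ)) :=
      Real.rpow_le_rpow_of_nonpos hR hle2 (by norm_num)
    exact mul_le_mul h1 h2 (Real.rpow_nonneg hk.le _) (Real.rpow_nonneg hk1.le _)
  have hnn : ∀ k : ℕ, 0 ≤ (((k + R + 1 : ℕ) : ℝ)) ^ (-(29 / 20 : ℝ)) := fun k ↦ Real.rpow_nonneg (by positivity) _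
  have hmaj : Summable (fun k : ℕ ↦ (((k + 1 : ℕ) : ℝ)) ^ (-(21 / 20 : ℝ)) * (((R + 1 : ℕ) : ℝ)) ^ (-(2 / 5 : ℝ))) :=
    summable_succ_rpow.mul_right _
  have hs : Summable (fun k : ℕ ↦ (((k + R + 1 : ℕ) : ℝ)) ^ (-(29 / 20 : ℝ))) :=
    Summable.of_nonneg_of_le hnn hpt hmaj
  refine ⟨hs, ?_⟩
  calc ∑' k : ℕ, (((k + R + 1 : ℕ) : ℝ)) ^ (-(29 / 20 : ℝ))
      ≤ ∑' k : ℕ, (((k + 1 : ℕ) : ℝ)) ^ (-(21 / 20 : ℝ)) * (((R + 1 : ℕ) : ℝ)) ^ (-(2 / 5 : ℝ)) :=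
        Summable.tsum_le_tsum hpt hs hmaj
    _ = (∑' k : ℕ, (((k + 1 : ℕ) : ℝ)) ^ (-(21 / 20 : ℝ))) * (((R + 1 : ℕ) : ℝ)) ^ (-(2 / 5 : ℝ)) :=
        tsum_mul_right

/-- **The double zeta majorant**: for `s > 1`, `(n₁,n₂) ↦ n₁^{−s} n₂^{−s}` is summable on `ℕ × ℕ` (terms with a zero index vanish). -/
theorem summable_prod_rpow {s : ℝ} (hs : 1 < s) :
    Summable (fun n : ℕ × ℕ ↦ ((n.1 : ℝ)) ^ (-s) * ((n.2 : ℝ)) ^ (-s)) := by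
  have h1 : Summable (fun n : ℕ ↦ ((n : ℝ)) ^ (-s)) := Real.summable_nat_rpow.mpr (by linarith)
  exact h1.mul_of_nonneg h1 (fun n ↦ Real.rpow_nonneg (Nat.cast_nonneg _) _)
    (fun n ↦ Real.rpow_nonneg (Nat.cast_nonneg _) _)

/-- `(n₁n₂)^{−s} = n₁^{−s} n₂^{−s}` on `ℕ × ℕ`. -/
theorem mul_rpow_neg_natCast (n₁ n₂ : ℕ) (s : ℝ) :
    (((n₁ : ℝ) * n₂) ^ (-s)) = ((n₁ : ℝ)) ^ (-s) * ((n₂ : ℝ)) ^ (-s) :=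
  Real.mul_rpow (Nat.cast_nonneg _) (Nat.cast_nonneg _)

end Summit.Parity.GeneralizedHardyLittlewood.Theorems.PrimeLevelFamEdgeIdeaDeltas.PeterssonLayers

end
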